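import Summits.Ventures.PercRepro.Night2StarMixed

/-!
# PercRepro — night-2: non-triangle singles and mixed pairs counted together (blind cell pub-perc-repro, night-2 gen 1)

`rec_ge_of_nontriangle_and_mixed`: for a set `N` of non-triangle points of a basis `B` and a set `P` of mixed pairs,
`rec(B) ≥ |N|/(4(q + 1)) + |P|/(12(q + 1))` (the two index families are disjoint: sizes `q + 1` and `q + 2`). Used by
`Night2StarLargeB` to lower the corank threshold of the type-`2` balance from `31` to `22`.
-/

namespace PercRepro.Star

open Finset ThmH SixFour GenQ

variable {α : Type*} [DecidableEq α] {M : Matroid α} [M.Finite]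

/-- **Non-triangle singles and mixed pairs together**: `rec(B) ≥ |N|/(4(q + 1)) + |P|/(12(q + 1))` for a set `N` of non-triangle
points and a set `P` of mixed pairs. -/
theorem rec_ge_of_nontriangle_and_mixed (hs : Simple M) {G B : Finset α} {q : ℕ} (hG : G ⊆ gr M)
    (hrG : M.eRk (G : Set α) = (q : ℕ∞)) (hB : B ∈ Bq M G q) (hq : 1 ≤ q) {N : Finset α} (hN : N ⊆ G \ B)
    (hnt : ∀ x ∈ N, mTr M (insert x B) + 3 ≤ q) {P : Finset (Finset α)} (hP : P ⊆ (G \ B).powersetCard 2)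
    (hmix : ∀ p ∈ P, ∃ x y, x ≠ y ∧ p = {x, y} ∧ mTr M (insert x B) + 2 = q ∧ mTr M (insert y B) + 3 ≤ q) :
    (N.card : ℚ) * (1 / (4 * ((q : ℚ) + 1))) + (P.card : ℚ) * (1 / (12 * ((q : ℚ) + 1))) ≤ rec M G q B := by
  set f : Finset α → ℚ := fun S => surplus M G q S / (bIn M G q S : ℚ) with hf
  have hf0 : ∀ S ∈ (SNq M G q).filter (fun S : Finset α => B ⊆ S), 0 ≤ f S := by
    intro S hS
    have hS' := (Finset.mem_filter.1 hS).1
    apply div_nonneg (surplus_nonneg hs hG hrG hS')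
    positivity
  -- singles
  set T1 : Finset (Finset α) := N.image (fun a => insert a B) with hT1
  have hT1sub : T1 ⊆ (SNq M G q).filter (fun S : Finset α => B ⊆ S) := by
    intro S hS
    rw [hT1, Finset.mem_image] at hS
    obtain ⟨a, ha, rfl⟩ := hS
    exact Finset.mem_filter.2 ⟨(insert_mem_SNq hrG hB (hN ha)).1, Finset.subset_insert a B⟩
  have hinj1 : Set.InjOn (fun a => insert a B) (N : Set α) := by
    intro a ha b _ hab
    exact eq_of_insert_eq (Finset.mem_sdiff.1 (hN (Finset.mem_coe.1 ha))).2 hab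
  -- pairs
  have hmem : ∀ p ∈ P, p ⊆ G \ B ∧ p.card = 2 := fun p hp => by
    have := Finset.mem_powersetCard.1 (hP hp)
    exact ⟨this.1, this.2⟩
  have hinj2 : Set.InjOn (fun p : Finset α => p ∪ B) (P : Set (Finset α)) := by
    intro p hp p' hp' heq
    have e : ∀ U ∈ P, (U ∪ B) \ B = U := by
      intro U hU
      rw [Finset.union_sdiff_right, Finset.sdiff_eq_self_iff_disjoint, Finset.disjoint_left]
      intro z hz hzB
      exact (Finset.mem_sdiff.1 ((hmem U hU).1 hz)).2 hzB
    simp only at heq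
    rw [← e p (Finset.mem_coe.1 hp), ← e p' (Finset.mem_coe.1 hp'), heq]
  set T2 : Finset (Finset α) := P.image (fun p : Finset α => p ∪ B) with hT2
  have hT2sub : T2 ⊆ (SNq M G q).filter (fun S : Finset α => B ⊆ S) := by
    intro S hS
    rw [hT2, Finset.mem_image] at hS
    obtain ⟨p, hp, rfl⟩ := hS
    obtain ⟨x, y, hxy, rfl, -, -⟩ := hmix p hp
    have hx : x ∈ G \ B := (hmem _ hp).1 (by simp)
    have hy : y ∈ G \ B := (hmem _ hp).1 (by simp)
    have e : ({x, y} : Finset α) ∪ B = insert x (insert y B) := by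
      ext z
      simp only [Finset.mem_union, Finset.mem_insert, Finset.mem_singleton]
      tauto
    rw [e]
    exact Finset.mem_filter.2 ⟨(insert_insert_mem_SNq hrG hB hx hy hxy).1,
      (Finset.subset_insert y B).trans (Finset.subset_insert x _)⟩
  -- disjoint (cards `q + 1` and `q + 2`)
  have hdisj : Disjoint T1 T2 := by
    rw [Finset.disjoint_left]
    intro S hS1 hS2
    rw [hT1, Finset.mem_image] at hS1
    rw [hT2, Finset.mem_image] at hS2
    obtain ⟨a, ha, rfl⟩ := hS1
    obtain ⟨p, hp, hpS⟩ := hS2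
    have h1 := congrArg Finset.card hpS
    have hpB : Disjoint p B := by
      rw [Finset.disjoint_left]
      intro z hz hzB
      exact (Finset.mem_sdiff.1 ((hmem p hp).1 hz)).2 hzB
    rw [Finset.card_union_of_disjoint hpB, (hmem p hp).2,
      Finset.card_insert_of_notMem (Finset.mem_sdiff.1 (hN ha)).2] at h1
    omega
  have hrec : ∑ S ∈ T1 ∪ T2, f S ≤ rec M G q B := by
    unfold rec
    apply Finset.sum_le_sum_of_subset_of_nonneg (Finset.union_subset hT1sub hT2sub)
    intro S hS _
    exact hf0 S hS
  rw [Finset.sum_union hdisj, hT1, hT2, Finset.sum_image hinj1, Finset.sum_image hinj2] at hrec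
  have hterm1 : ∀ a ∈ N, 1 / (4 * ((q : ℚ) + 1)) ≤ f (insert a B) := fun a ha =>
    nontriangle_term_ge hs hG hrG hB hq (hN ha) (hnt a ha)
  have hterm2 : ∀ p ∈ P, 1 / (12 * ((q : ℚ) + 1)) ≤ f (p ∪ B) := by
    intro p hp
    obtain ⟨x, y, hxy, rfl, hmx, hmy⟩ := hmix p hp
    have hx : x ∈ G \ B := (hmem _ hp).1 (by simp)
    have hy : y ∈ G \ B := (hmem _ hp).1 (by simp)
    have e : ({x, y} : Finset α) ∪ B = insert x (insert y B) := by
      ext z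
      simp only [Finset.mem_union, Finset.mem_insert, Finset.mem_singleton]
      tauto
    show 1 / (12 * ((q : ℚ) + 1)) ≤ surplus M G q ({x, y} ∪ B) / (bIn M G q ({x, y} ∪ B) : ℚ)
    rw [e]
    exact mixed_pair_term_ge hs hG hrG hB hq hx hy hxy hmx hmy
  have hsum1 := Finset.card_nsmul_le_sum N _ _ hterm1
  have hsum2 := Finset.card_nsmul_le_sum P _ _ hterm2
  rw [nsmul_eq_mul] at hsum1 hsum2
  simp only [hf] at hrec hsum1 hsum2
  linarith

end PercRepro.Star
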